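import Summits.RiemannHypothesis.RiemannHypothesis.Theorems.TwoPrimeFoldRigidity.Negative.TensorReduction

/-!
# Disproof of `TwoPrimeFoldRigidity` (K1, item stmt-RiemannHypothesis-25784) — findings (cdisprove g0, 2026-08-28)

HONEST LABEL: record-negative programme; 0 toward RH; nothing here bears on the truth of RH.

VERDICT: **K1 is false (refuted-substantive).**  Kernel-checked end to end (standalone evidence file
`StandaloneRefutation.lean` on the item: rc 0, 0 sorry, axioms {propext, Classical.choice, Quot.sound}); tree landing:
`Negative/TensorReduction.lean` (p654599, accepted) + `Negative/MBTDefs.lean` (p656656, accepted) + six theorem-only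
parts `MBTCubedGon → MBTLevels → MBTSolve → MBTConditioning → MBTBudget → MomentBlindTower` + the refutation
`Theorems/IntegerScrewTwoPrimeFoldRigidityRefutation.lean` (`IntegerScrewTwoPrimeFoldRigidity_refuted`).

MECHANISM (new this seat; supersedes the coupled two-lattice towers of Lines/spill_budget (L64) and
Lines/theta_uniform (w9 T2), which need cross-lattice spill budgets):
1. *Tensor reduction* (`twoPrimeFoldRigidity_false_of_towers`, below re-exported as an implication from tower
   existence): given ONE-lattice moment-blind towers for `log 2` and for `log 3` — positive locally finite families
   in `0 < Re κ < 1/4`, `Im κ > 1`, `Σ μ|κ|² < ∞`, whose moment sums `Σ μ conj(κ)^r e^{κ k h}` (`r = 0,1,2`) vanish for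
   all `k ≥ 1` — the product family `κ_p + κ'_q`, `m = μν|κ_p+κ'_q|⁴/4` is admissible for K1 and BOTH folds are
   bounded: the growing part `Σ m conj(K)² e^{K t}/|K|⁴·4 = Σ_{a+b=2} C(2,a) A_a(t) B_b(t)` factorises and one factor
   vanishes on each lattice; the decaying/constant parts are absolutely bounded.  No Diophantine input at all.
2. *One-lattice towers exist* (`MBT.momentBlindTower_exists`): levels `m ≥ 0` of eleven cubed gons of order
   `n_m = K₀(m+1)` at abscissa `σ_m = 1/4 − 20/(n_m h)` (sup not attained — forced, cf. `ScrewLatticeSupB1`); a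
   cubed gon is invisible (moments ≤ 2) at times not divisible by its order and shows `e^{(σ+iγ)t} n³ W_r` at
   multiples; each level cancels, by an exact six-unknown solve on two phase-conjugate quintuples plus a forcing gon
   and a binomial null shift for positivity, the spill of the earlier levels whose order divides its own; spill into
   the `j`-th multiple decays like `e^{-20(j-1)}`, giving the budget `E_m ≤ 2·10⁶ (m+1)⁻⁴` and summable masses.

LOAD-BEARING ANALYSIS of K1's hypotheses against this witness: positivity, strip `0 < Re κ < 1/2` (we use `< 1/2`
via `1/4 + 1/4`), `Im κ > 1` (ours `> 2`), local finiteness, `Σ m/Im² < ∞` (ours even `Σ m|κ|² < ∞`-type decay) — ALL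
met; the only lever K1 has is "two independent lattices", and that lever is what fails.  Strengthenings that are
killed the same way: any finite set of steps `h_1..h_s` (tensor `s` towers), any strip width `δ` (rescale), any
polynomial mass decay (raise `L`).  A repair must change the sampling set to a non-lattice one (different statement).

NO near-misses / sorries: nothing of this line is open.
-/

set_option linter.dupNamespace false

namespace Summit.RiemannHypothesis.RiemannHypothesis.Cruxes.TwoPrimeFoldRigidity.Disproof

open scoped ComplexConjugate

/-- The precise one-lattice tower hypothesis (now a THEOREM of the tree chain, `MBT.momentBlindTower_exists`):
for step `h`, a nonempty admissible family in `Re κ < 1/4` whose moment sums of orders `0,1,2` vanish on `hℕ⁺`. -/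
def TowerExists (h : ℝ) : Prop :=
  ∃ (ι : Type) (μ : ι → ℝ) (κ : ι → ℂ), Nonempty ι ∧ (∀ i, 0 < μ i) ∧
    (∀ i, 0 < (κ i).re ∧ (κ i).re < 1 / 4) ∧ (∀ i, 1 < (κ i).im) ∧
    (∀ T : ℝ, {i | (κ i).im ≤ T}.Finite) ∧ Summable (fun i ↦ μ i * ‖κ i‖ ^ 2) ∧
    ∀ k : ℕ, 1 ≤ k → ∀ r : ℕ, r ≤ 2 →
      HasSum (fun i ↦ (μ i : ℂ) * conj (κ i) ^ r * Complex.exp (κ i * (((k : ℝ) * h : ℝ) : ℂ))) 0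

/-- **Tensor reduction, packaged**: towers for `log 2` and `log 3` refute K1 (from the accepted
`Negative/TensorReduction`).  Both hypotheses are discharged by `MBT.momentBlindTower_exists` in the tree chain. -/
theorem twoPrimeFoldRigidity_false_of_towers (h2 : TowerExists (Real.log 2)) (h3 : TowerExists (Real.log 3)) :
    ¬ Summit.RiemannHypothesis.RiemannHypothesis.Theses.IntegerScrew.TwoPrimeFoldRigidity := by
  obtain ⟨P, μ, κ, hne, hμ, hre, him, hfin, hsum, hbl⟩ := h2
  obtain ⟨Q, ν, κ', hne', hν, hre', him', hfin', hsum', hbl'⟩ := h3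
  exact Theorems.TwoPrimeFoldRigidity.Negative.twoPrimeFoldRigidity_false_of_towers hne hne' μ κ ν κ' hμ hre him
    hfin hsum hbl hν hre' him' hfin' hsum' hbl'

/-! ## HANDOFF
landed: p654599 TensorReduction, p656656 MBTDefs; in flight: MBTCubedGon … MomentBlindTower, then the refutation file.
sorried: nothing.  next regimes: none needed (kill complete); optional follow-ups for planners: (i) the same towers
refute every finite-lattice variant of K1; (ii) barrier card "finite unions of sampling lattices are blind". -/

end Summit.RiemannHypothesis.RiemannHypothesis.Cruxes.TwoPrimeFoldRigidity.Disproof
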